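import Summits.PneNP.PneNP.Theorems.ConstantBand.Negative.LoadBearing
import Summits.PneNP.PneNP.Theorems.SingleThreshold.Negative.Locality
import Summits.PneNP.PneNP.Theorems.SliceACZero.Negative.DeltaBeforeK
import Literature.Computability.Complexity.CliqueThresholdBounds

/-!
# Route OneSlice, crux `SliceTarget` (stmt-PneNP-2832), line `Sketch-ideator3-r1`: stub T6 `stub_transfer`
# (the assembly of both strata of the crux from the registered stubs T1–T5, T7)

The crux X = `Summit.PneNP.PneNP.Theses.OneSlice.SliceTarget` is literally `∀ c, SliceTargetAt c` with
`SliceTargetAt c = ∃ k ≥ 3, ∃ δ > 0, ∀ᶠ n, ∀ central j, ∀ {∧₂,∨₂}-circuit C, #errSet ≤ δ·#slice → n^c < |C|`.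
This file proves the registered stub `stub_transfer` of the line skeleton `Cruxes/SliceTarget/Lines/Sketch-ideator3-r1.lean`:
the implication `T1 → T2 → T3 → T4 → T5 → T7 → ∀ c, SliceTargetAt c`, with every hypothesis written out over the
landed vocabulary (`Edge/thr/Central/slice/errSet` of `ConstantBand.Negative.LoadBearing`, `Touch/zeroOn/inputList` of
`SingleThreshold.Negative.{Independence,Locality}`):

* stratum `c ≤ 1` (`sliceLB_of_locality`): the LOCALITY FLOOR on the slice, `k = 4`, `δ = α₀/4` with
  `α₀ = min α (1/2)` — a `{∧₂,∨₂}`-circuit with `≤ n^c ≤ n` gates reads `≤ 2n+1 ≤ 3n` slots `F`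
  (`length_inputList_le`), its output is `F`-determined (`eval_congr`), the `F`-blind clique indicator
  `CLIQUE_4(x ∖ F)` has both values with fibre density `≥ α₀` (T3, T4), so the circuit disagrees with it on
  `≥ α₀·#slice_j` graphs (T2), and it disagrees with `CLIQUE_4` itself off the touching event, of size
  `≤ 3n·C(n−2,2)·(j/C(n,2))⁶·#slice_j ≤ (192/n)·#slice_j` (T1 and the window bookkeeping `window_four`);
* stratum `c ≥ 2` (`sliceLB_of_parity`): the PARITY COINCIDENCE transfer — `CLIQUE_k(x) = [2 ∤ ω_k(x)]` whenever
  `ω_k(x) ≤ 1`, so `#{C ≠ parity} ≤ #errSet + #{ω_k ≥ 2} ≤ (δ_X + (1/k!)²/2 + ε)·#slice ≤ δ·#slice` with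
  `δ_X = ε = (δ − (1/k!)²)/4` (T5), and T7 applies.

Window lemmas (`thr_ge'`, `central_bounds'`) are adapted from `Cruxes/SliceTarget/Disproof.lean` (not importable).
Lead prover-line-stmt-PneNP-2832-0, 2026-08-16.
-/

set_option linter.dupNamespace false

namespace Summit.PneNP.PneNP.Cruxes.SliceTarget.Ideator3Line

open Literature.Computability.Complexity Finset Filter Classical
open scoped Topology
open Summit.PneNP.PneNP.Theorems.ConstantBand.Negative (Edge thr Central slice errSet)
open Summit.PneNP.PneNP.Theorems.SingleThreshold.Negative (Edges Touch zeroOn inputList eval_congr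
  length_inputList_le arity_le_two_of_isOver touch_of_ne pc pc_nonneg pc_le_one tendsto_pc pc_pow_choose)
open Summit.PneNP.PneNP.Theorems.SliceACZero.Negative (sliceCard sliceCard_eq)

noncomputable section

/-! ## Window bookkeeping at `k = 4` (adapted from Cruxes/SliceTarget/Disproof.lean §4) -/

-- adapted from Cruxes/SliceTarget/Disproof.lean (`inv_le_rpow_threshold`, `thr_ge`, `central_bounds`)
/-- `n^{-1} ≤ n^{-2/(k-1)}` for `k ≥ 3`. [folklore] -/
theorem inv_le_rpow_threshold' {k n : ℕ} (hk : 3 ≤ k) (hn : 1 ≤ n) :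
    (n : ℝ)⁻¹ ≤ (n : ℝ) ^ (-(2 : ℝ) / ((k : ℝ) - 1)) := by
  have hn1 : (1 : ℝ) ≤ n := by exact_mod_cast hn
  rw [← Real.rpow_neg_one]
  apply Real.rpow_le_rpow_of_exponent_le hn1
  have hk' : (3 : ℝ) ≤ k := by exact_mod_cast hk
  rw [neg_div, neg_le_neg_iff, div_le_one (by linarith)]
  linarith

/-- **The threshold edge count is unbounded**: `m_k(n) ≥ (n-1)/2 - 1` for `k ≥ 3`. [folklore] -/
theorem thr_ge' {k n : ℕ} (hk : 3 ≤ k) (hn : 1 ≤ n) : ((n : ℝ) - 1) / 2 - 1 ≤ thr k n := by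
  have hT : ((n : ℝ) - 1) / 2 ≤ (n.choose 2 : ℕ) * (n : ℝ) ^ (-(2 : ℝ) / ((k : ℝ) - 1)) := by
    have hn0 : (n : ℝ) ≠ 0 := by exact_mod_cast (show n ≠ 0 by omega)
    calc ((n : ℝ) - 1) / 2 = (n.choose 2 : ℕ) * (n : ℝ)⁻¹ := by
          rw [Nat.cast_choose_two]; field_simp
      _ ≤ _ := mul_le_mul_of_nonneg_left (inv_le_rpow_threshold' hk hn) (Nat.cast_nonneg _)
  have hfl := Nat.lt_floor_add_one (((n.choose 2 : ℕ) : ℝ) * (n : ℝ) ^ (-(2 : ℝ) / ((k : ℝ) - 1)))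
  rw [thr]
  linarith

/-- The threshold is at most `C(n,2) · n^{-2/(k-1)}` (it is its floor). [folklore] -/
theorem thr_le_mul_pc (k n : ℕ) : (thr k n : ℝ) ≤ (n.choose 2 : ℕ) * pc n k := by
  rw [thr, pc]
  exact Nat.floor_le (mul_nonneg (Nat.cast_nonneg _) (Real.rpow_nonneg (Nat.cast_nonneg _) _))

/-- Central edge counts lie in `[m/2, 2m]` once `m = m_k(n) ≥ 16` (`m^{3/4} ≤ m/2`). [folklore] -/
theorem central_bounds' {k n j : ℕ} (hj : Central k n j) (h16 : 16 ≤ thr k n) :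
    (thr k n : ℝ) / 2 ≤ j ∧ (j : ℝ) ≤ 2 * thr k n := by
  have hT : (16 : ℝ) ≤ thr k n := by exact_mod_cast h16
  have hpow : (thr k n : ℝ) ^ ((3 : ℝ) / 4) ≤ thr k n / 2 := by
    -- `m^{3/4} ≤ m/2 ⟺ 2 ≤ m^{1/4} ⟺ 16 ≤ m`
    have h0 : (0 : ℝ) ≤ thr k n := by linarith
    have hq : (2 : ℝ) ≤ (thr k n : ℝ) ^ ((1 : ℝ) / 4) := by
      have h16' : (16 : ℝ) = 2 ^ (4 : ℝ) := by norm_num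
      calc (2 : ℝ) = ((2 : ℝ) ^ (4 : ℝ)) ^ ((1 : ℝ) / 4) := by
            rw [← Real.rpow_mul (by norm_num)]; norm_num
        _ ≤ (thr k n : ℝ) ^ ((1 : ℝ) / 4) := by
            apply Real.rpow_le_rpow (by norm_num) _ (by norm_num)
            rw [← h16']; exact hT
    have hsplit : (thr k n : ℝ) = (thr k n : ℝ) ^ ((3 : ℝ) / 4) * (thr k n : ℝ) ^ ((1 : ℝ) / 4) := by
      rw [← Real.rpow_add' h0 (by norm_num)]
      norm_num
    have h34 : 0 ≤ (thr k n : ℝ) ^ ((3 : ℝ) / 4) := Real.rpow_nonneg h0 _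
    nlinarith
  obtain ⟨hlo, hhi⟩ := abs_sub_le_iff.1 hj
  constructor <;> linarith

/-- **Window package at `k = 4`.** Eventually in `n`, for every central `j`:
`6 ≤ j ≤ C(n,2)`, `j / C(n,2) ≤ 2 · n^{-2/3}`, and `0 < C(n,2)`. [folklore] -/
theorem window_four : ∀ᶠ n : ℕ in atTop, ∀ j : ℕ, Central 4 n j →
    6 ≤ j ∧ j ≤ n.choose 2 ∧ (j : ℝ) / (n.choose 2 : ℕ) ≤ 2 * pc n 4 ∧ 0 < n.choose 2 := by
  have hpc : ∀ᶠ n : ℕ in atTop, pc n 4 ≤ 1 / 2 :=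
    (tendsto_pc (by norm_num : 2 ≤ 4)).eventually (eventually_le_nhds (by norm_num))
  filter_upwards [hpc, eventually_ge_atTop 40] with n hp hn j hj
  have hn1 : 1 ≤ n := by omega
  have hthr : (16 : ℝ) ≤ thr 4 n := by
    have h := thr_ge' (k := 4) (by norm_num) hn1
    have h40 : (40 : ℝ) ≤ n := by exact_mod_cast hn
    linarith
  have hthr' : 16 ≤ thr 4 n := by exact_mod_cast hthr
  obtain ⟨hlo, hhi⟩ := central_bounds' hj hthr'
  have hN : 0 < n.choose 2 := Nat.choose_pos (by omega)
  have hNr : (0 : ℝ) < (n.choose 2 : ℕ) := by exact_mod_cast hN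
  have hTle := thr_le_mul_pc 4 n
  have hjle : (j : ℝ) ≤ 2 * ((n.choose 2 : ℕ) * pc n 4) := hhi.trans (by linarith)
  refine ⟨?_, ?_, ?_, hN⟩
  · have : (6 : ℝ) ≤ j := by linarith
    exact_mod_cast this
  · have : (j : ℝ) ≤ (n.choose 2 : ℕ) := by nlinarith
    exact_mod_cast this
  · rw [div_le_iff₀ hNr]
    linarith

/-- The touching budget at `k = 4`: `3n · C(n-2,2) · (2 n^{-2/3})^6 ≤ 192/n` (`n ≥ 1`). [folklore] -/
theorem touchBudget_four {n : ℕ} (hn : 1 ≤ n) :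
    (3 * (n : ℝ)) * (((n - 2).choose 2 : ℕ) : ℝ) * (2 * pc n 4) ^ 6 ≤ 192 / (n : ℝ) := by
  have hn0 : (0 : ℝ) < n := by exact_mod_cast hn
  have h42 : Nat.choose 4 2 = 6 := by decide
  have hp6 : pc n 4 ^ 6 = ((n : ℝ) ^ 4)⁻¹ := by
    have := pc_pow_choose (k := 4) hn (by norm_num)
    rwa [h42] at this
  have hC : (((n - 2).choose 2 : ℕ) : ℝ) ≤ (n : ℝ) ^ 2 := by
    have ha : (n - 2).choose 2 ≤ (n - 2) ^ 2 := Nat.choose_le_pow _ _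
    have hb : (n - 2) ^ 2 ≤ n ^ 2 := Nat.pow_le_pow_left (Nat.sub_le n 2) _
    exact_mod_cast ha.trans hb
  rw [mul_pow, hp6]
  have hC0 : (0 : ℝ) ≤ (((n - 2).choose 2 : ℕ) : ℝ) := Nat.cast_nonneg _
  calc (3 * (n : ℝ)) * (((n - 2).choose 2 : ℕ) : ℝ) * ((2 : ℝ) ^ 6 * ((n : ℝ) ^ 4)⁻¹)
      ≤ (3 * (n : ℝ)) * (n : ℝ) ^ 2 * ((2 : ℝ) ^ 6 * ((n : ℝ) ^ 4)⁻¹) := by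
        have : (0 : ℝ) ≤ (2 : ℝ) ^ 6 * ((n : ℝ) ^ 4)⁻¹ := by positivity
        gcongr
    _ = 192 / (n : ℝ) := by
        field_simp
        ring

/-! ## Stratum `c ≤ 1`: the locality floor on the slice -/

/-- **Locality floor.** From T1 (slice touching bound), T2 (fibre decoupling), T3/T4 (two-sided fibre clique
densities) — for `c ≤ 1`, at `k = 4` there is `δ > 0` with `SliceLBAt c 4 δ`. [folklore] -/
theorem sliceLB_of_locality {c : ℕ} (hc : c ≤ 1)
    (hTouch : ∀ (n k j : ℕ) (F : Finset (Edge n)), k.choose 2 ≤ j → j ≤ n.choose 2 →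
      (#((slice n j).filter fun x => Touch n k F x) : ℝ) ≤
        (#F : ℝ) * ((n - 2).choose (k - 2) : ℝ) * (((j : ℝ) / (n.choose 2 : ℕ)) ^ (k.choose 2)) * #(slice n j))
    (hFib : ∀ (n j : ℕ) (F : Finset (Edge n)) (f g : (Edge n → Bool) → Bool) (α : ℝ),
      (∀ x y : Edge n → Bool, (∀ e ∈ F, x e = y e) → f x = f y) →
      (∀ (ρ : Edge n → Bool) (b : Bool),
        α * #((slice n j).filter fun x => ∀ e ∈ F, x e = ρ e) ≤
          #((slice n j).filter fun x => (∀ e ∈ F, x e = ρ e) ∧ g x = b)) →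
      α * #(slice n j) ≤ #((slice n j).filter fun x => f x ≠ g x))
    (hLow : ∀ k : ℕ, 4 ≤ k → ∃ α : ℝ, 0 < α ∧ ∀ᶠ n : ℕ in atTop, ∀ j : ℕ, Central k n j →
      ∀ F : Finset (Edge n), #F ≤ 3 * n → ∀ ρ : Edge n → Bool,
        α * #((slice n j).filter fun x => ∀ e ∈ F, x e = ρ e) ≤
          #((slice n j).filter fun x => (∀ e ∈ F, x e = ρ e) ∧ cliqueFn n k (zeroOn F x) = true))
    (hUp : ∀ k : ℕ, 3 ≤ k → ∀ᶠ n : ℕ in atTop, ∀ j : ℕ, Central k n j →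
      ∀ F : Finset (Edge n), #F ≤ 3 * n → ∀ ρ : Edge n → Bool,
        (1 / 2 : ℝ) * #((slice n j).filter fun x => ∀ e ∈ F, x e = ρ e) ≤
          #((slice n j).filter fun x => (∀ e ∈ F, x e = ρ e) ∧ cliqueFn n k (zeroOn F x) = false)) :
    ∃ δ : ℝ, 0 < δ ∧ ∀ᶠ n : ℕ in atTop, ∀ j : ℕ, Central 4 n j → ∀ C : Circuit (Edge n),
      C.IsOver monotoneBasis → (#(errSet n 4 j C) : ℝ) ≤ δ * #(slice n j) → n ^ c < C.size := by
  obtain ⟨α, hα, hLow4⟩ := hLow 4 le_rfl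
  have hUp4 := hUp 4 (by norm_num)
  set α₀ : ℝ := min α (1 / 2) with hα₀
  have hα₀pos : 0 < α₀ := lt_min hα (by norm_num)
  have hα₀α : α₀ ≤ α := min_le_left _ _
  have hα₀h : α₀ ≤ 1 / 2 := min_le_right _ _
  -- the touching budget vanishes
  have hτ : ∀ᶠ n : ℕ in atTop, (192 : ℝ) / n ≤ α₀ / 2 := by
    have := tendsto_const_div_atTop_nhds_zero_nat (192 : ℝ)
    exact this.eventually (eventually_le_nhds (by positivity))
  refine ⟨α₀ / 4, by positivity, ?_⟩
  filter_upwards [hLow4, hUp4, window_four, hτ, eventually_ge_atTop 1] with n hL hU hW hτn hn1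
  intro j hj C hC herr
  obtain ⟨h6, hjN, hjq, hN⟩ := hW j hj
  by_contra hsize
  push Not at hsize
  -- the slots `C` reads
  set F : Finset (Edge n) := (inputList C).toFinset with hFdef
  have hFmem : ∀ i ∈ inputList C, i ∈ F := fun i hi => List.mem_toFinset.2 hi
  have hFcard : #F ≤ 3 * n := by
    have h1 : #F ≤ (inputList C).length := List.toFinset_card_le _
    have h2 := length_inputList_le C (arity_le_two_of_isOver hC)
    have h3 : C.size ≤ n := by
      refine hsize.trans ?_
      rcases Nat.le_one_iff_eq_zero_or_eq_one.1 hc with rfl | rfl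
      · simp; omega
      · simp
    omega
  -- `f` = the circuit, `g` = the `F`-blind clique indicator
  set f : (Edge n → Bool) → Bool := fun x => C.eval x with hfdef
  set g : (Edge n → Bool) → Bool := fun x => cliqueFn n 4 (zeroOn F x) with hgdef
  have hf : ∀ x y : Edge n → Bool, (∀ e ∈ F, x e = y e) → f x = f y :=
    fun x y hxy => eval_congr C fun i hi => hxy i (hFmem i hi)
  have hfibre : ∀ (ρ : Edge n → Bool) (b : Bool),
      α₀ * #((slice n j).filter fun x => ∀ e ∈ F, x e = ρ e) ≤
        #((slice n j).filter fun x => (∀ e ∈ F, x e = ρ e) ∧ g x = b) := by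
    intro ρ b
    have hΦ : (0 : ℝ) ≤ #((slice n j).filter fun x => ∀ e ∈ F, x e = ρ e) := Nat.cast_nonneg _
    cases b
    · exact (mul_le_mul_of_nonneg_right hα₀h hΦ).trans (hU j hj F hFcard ρ)
    · exact (mul_le_mul_of_nonneg_right hα₀α hΦ).trans (hL j hj F hFcard ρ)
  have hdec : α₀ * #(slice n j) ≤ #((slice n j).filter fun x => f x ≠ g x) := hFib n j F f g α₀ hf hfibre
  -- `{f ≠ g} ⊆ errSet ∪ Touch`
  have hsub : ((slice n j).filter fun x => f x ≠ g x) ⊆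
      errSet n 4 j C ∪ (slice n j).filter fun x => Touch n 4 F x := by
    intro x hx
    rw [mem_filter] at hx
    obtain ⟨hxs, hne⟩ := hx
    rw [mem_union]
    by_cases hE : C.eval x ≠ cliqueFn n 4 x
    · left
      exact mem_filter.2 ⟨mem_univ _, (mem_filter.1 hxs).2, hE⟩
    · right
      push Not at hE
      refine mem_filter.2 ⟨hxs, touch_of_ne F x ?_⟩
      intro hzg
      apply hne
      simp only [hfdef, hgdef]
      rw [hE, hzg]
  have hcard : (#((slice n j).filter fun x => f x ≠ g x) : ℝ) ≤
      #(errSet n 4 j C) + #((slice n j).filter fun x => Touch n 4 F x) := by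
    have := (card_le_card hsub).trans (card_union_le _ _)
    exact_mod_cast this
  -- the touching term
  have hS0 : (0 : ℝ) ≤ #(slice n j) := Nat.cast_nonneg _
  have htouch : (#((slice n j).filter fun x => Touch n 4 F x) : ℝ) ≤ α₀ / 2 * #(slice n j) := by
    have h42 : Nat.choose 4 2 = 6 := by decide
    have h1 := hTouch n 4 j F (by rw [h42]; exact h6) hjN
    have hq0 : (0 : ℝ) ≤ (j : ℝ) / (n.choose 2 : ℕ) := by positivity
    have h2 : ((j : ℝ) / (n.choose 2 : ℕ)) ^ (Nat.choose 4 2) ≤ (2 * pc n 4) ^ 6 := by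
      rw [h42]
      exact pow_le_pow_left₀ hq0 hjq 6
    have hF3 : (#F : ℝ) ≤ 3 * n := by exact_mod_cast hFcard
    have hC0 : (0 : ℝ) ≤ (((n - 2).choose (4 - 2) : ℕ) : ℝ) := Nat.cast_nonneg _
    have h3 : (#F : ℝ) * ((n - 2).choose (4 - 2) : ℕ) * ((j : ℝ) / (n.choose 2 : ℕ)) ^ (Nat.choose 4 2) ≤
        (3 * (n : ℝ)) * (((n - 2).choose 2 : ℕ) : ℝ) * (2 * pc n 4) ^ 6 := by
      have h22 : (4 : ℕ) - 2 = 2 := by norm_num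
      rw [h22]
      have : (0 : ℝ) ≤ ((j : ℝ) / (n.choose 2 : ℕ)) ^ (Nat.choose 4 2) := pow_nonneg hq0 _
      gcongr
    have h4 := touchBudget_four hn1
    calc (#((slice n j).filter fun x => Touch n 4 F x) : ℝ)
        ≤ (#F : ℝ) * ((n - 2).choose (4 - 2) : ℕ) * ((j : ℝ) / (n.choose 2 : ℕ)) ^ (Nat.choose 4 2) *
            #(slice n j) := h1
      _ ≤ (192 : ℝ) / n * #(slice n j) := by
          refine mul_le_mul_of_nonneg_right (h3.trans h4) hS0
      _ ≤ α₀ / 2 * #(slice n j) := mul_le_mul_of_nonneg_right hτn hS0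
  -- the slice is non-empty
  have hSpos : (0 : ℝ) < #(slice n j) := by
    have : #(slice n j) = (n.choose 2).choose j := sliceCard_eq n j
    rw [this]
    exact_mod_cast Nat.choose_pos hjN
  -- assemble: `α₀ S ≤ #err + α₀/2 S` and `#err ≤ α₀/4 S`
  nlinarith

/-! ## Stratum `c ≥ 2`: the parity coincidence transfer -/

/-- **Pointwise coincidence off the tail**: if `ω_k(x) ≤ 1` then `CLIQUE_k(x) = [2 ∤ ω_k(x)]`. [folklore] -/
theorem cliqueFn_eq_parity_of_lt_two {n k : ℕ} (x : Edge n → Bool) (h : cliqueCount n k x < 2) :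
    cliqueFn n k x = decide (¬ 2 ∣ cliqueCount n k x) := by
  by_cases h0 : cliqueCount n k x = 0
  · rw [(cliqueCount_eq_zero_iff x).1 h0, h0]
    decide
  · have h1 : cliqueCount n k x = 1 := by omega
    rw [(cliqueCount_ne_zero_iff x).1 h0, h1]
    decide

/-- **Parity transfer.** From T5 (the tail `{ω_k ≥ 2}` has density `≤ (1/k!)²/2 + ε`) and the parity hardness
clause of T7 at `(c, k, δ)` with `(1/k!)² < δ`: `SliceLBAt c k δ'` with `δ' = (δ − (1/k!)²)/4`. [folklore] -/
theorem sliceLB_of_parity {c k : ℕ} {δ : ℝ} (hδ : (1 / (k.factorial : ℝ)) ^ 2 < δ)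
    (hTail : ∀ ε : ℝ, 0 < ε → ∀ᶠ n : ℕ in atTop, ∀ j : ℕ, Central k n j →
      (#((slice n j).filter fun x => 2 ≤ cliqueCount n k x) : ℝ) ≤
        ((1 / (k.factorial : ℝ)) ^ 2 / 2 + ε) * #(slice n j))
    (hPar : ∀ᶠ n : ℕ in atTop, ∀ j : ℕ, Central k n j → ∀ C : Circuit (Edge n), C.IsOver monotoneBasis →
        (#((slice n j).filter fun x => C.eval x ≠ decide (¬ 2 ∣ cliqueCount n k x)) : ℝ) ≤ δ * #(slice n j) →
          n ^ c < C.size) :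
    ∃ δ' : ℝ, 0 < δ' ∧ ∀ᶠ n : ℕ in atTop, ∀ j : ℕ, Central k n j → ∀ C : Circuit (Edge n),
      C.IsOver monotoneBasis → (#(errSet n k j C) : ℝ) ≤ δ' * #(slice n j) → n ^ c < C.size := by
  set lam2 : ℝ := (1 / (k.factorial : ℝ)) ^ 2 with hlam2
  have hlam0 : 0 ≤ lam2 := by positivity
  set ε : ℝ := (δ - lam2) / 4 with hε
  have hε0 : 0 < ε := by rw [hε]; linarith
  refine ⟨ε, hε0, ?_⟩
  filter_upwards [hTail ε hε0, hPar] with n hT hP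
  intro j hj C hC herr
  apply hP j hj C hC
  -- `{C ≠ parity} ⊆ errSet ∪ {ω ≥ 2}`
  have hsub : ((slice n j).filter fun x => C.eval x ≠ decide (¬ 2 ∣ cliqueCount n k x)) ⊆
      errSet n k j C ∪ (slice n j).filter fun x => 2 ≤ cliqueCount n k x := by
    intro x hx
    rw [mem_filter] at hx
    obtain ⟨hxs, hne⟩ := hx
    rw [mem_union]
    by_cases h2 : 2 ≤ cliqueCount n k x
    · exact Or.inr (mem_filter.2 ⟨hxs, h2⟩)
    · left
      refine mem_filter.2 ⟨mem_univ _, (mem_filter.1 hxs).2, ?_⟩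
      rwa [cliqueFn_eq_parity_of_lt_two x (by omega)]
  have hcard : (#((slice n j).filter fun x => C.eval x ≠ decide (¬ 2 ∣ cliqueCount n k x)) : ℝ) ≤
      #(errSet n k j C) + #((slice n j).filter fun x => 2 ≤ cliqueCount n k x) := by
    have := (card_le_card hsub).trans (card_union_le _ _)
    exact_mod_cast this
  have hS0 : (0 : ℝ) ≤ #(slice n j) := Nat.cast_nonneg _
  have hT' := hT j hj
  have hδε : ε + (lam2 / 2 + ε) ≤ δ := by rw [hε]; linarith
  calc (#((slice n j).filter fun x => C.eval x ≠ decide (¬ 2 ∣ cliqueCount n k x)) : ℝ)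
      ≤ #(errSet n k j C) + #((slice n j).filter fun x => 2 ≤ cliqueCount n k x) := hcard
    _ ≤ ε * #(slice n j) + (lam2 / 2 + ε) * #(slice n j) := add_le_add herr hT'
    _ = (ε + (lam2 / 2 + ε)) * #(slice n j) := by ring
    _ ≤ δ * #(slice n j) := mul_le_mul_of_nonneg_right hδε hS0

/-! ## The registered stub -/

/-- **stub T6 `stub_transfer`** of line `Sketch-ideator3-r1` (crux stmt-PneNP-2832): the stubs T1 (slice touching
bound), T2 (fibre decoupling), T3/T4 (two-sided fibre clique densities), T5 (coincidence tail) and T7 (parity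
hardness from exponent 2) imply `∀ c, SliceTargetAt c` — i.e. the crux, by the definitional stratification
`SliceTarget ↔ ∀ c, SliceTargetAt c`. Exponents `c ≤ 1` by the locality floor at `k = 4`; `c ≥ 2` by the parity
transfer. [folklore] -/
theorem stub_transfer :
    (∀ (n k j : ℕ) (F : Finset (Edge n)), k.choose 2 ≤ j → j ≤ n.choose 2 →
      (#((slice n j).filter fun x => Touch n k F x) : ℝ) ≤
        (#F : ℝ) * ((n - 2).choose (k - 2) : ℝ) * (((j : ℝ) / (n.choose 2 : ℕ)) ^ (k.choose 2)) * #(slice n j)) →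
    (∀ (n j : ℕ) (F : Finset (Edge n)) (f g : (Edge n → Bool) → Bool) (α : ℝ),
      (∀ x y : Edge n → Bool, (∀ e ∈ F, x e = y e) → f x = f y) →
      (∀ (ρ : Edge n → Bool) (b : Bool),
        α * #((slice n j).filter fun x => ∀ e ∈ F, x e = ρ e) ≤
          #((slice n j).filter fun x => (∀ e ∈ F, x e = ρ e) ∧ g x = b)) →
      α * #(slice n j) ≤ #((slice n j).filter fun x => f x ≠ g x)) →
    (∀ k : ℕ, 4 ≤ k → ∃ α : ℝ, 0 < α ∧ ∀ᶠ n : ℕ in atTop, ∀ j : ℕ, Central k n j →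
      ∀ F : Finset (Edge n), #F ≤ 3 * n → ∀ ρ : Edge n → Bool,
        α * #((slice n j).filter fun x => ∀ e ∈ F, x e = ρ e) ≤
          #((slice n j).filter fun x => (∀ e ∈ F, x e = ρ e) ∧ cliqueFn n k (zeroOn F x) = true)) →
    (∀ k : ℕ, 3 ≤ k → ∀ᶠ n : ℕ in atTop, ∀ j : ℕ, Central k n j →
      ∀ F : Finset (Edge n), #F ≤ 3 * n → ∀ ρ : Edge n → Bool,
        (1 / 2 : ℝ) * #((slice n j).filter fun x => ∀ e ∈ F, x e = ρ e) ≤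
          #((slice n j).filter fun x => (∀ e ∈ F, x e = ρ e) ∧ cliqueFn n k (zeroOn F x) = false)) →
    (∀ k : ℕ, 3 ≤ k → ∀ ε : ℝ, 0 < ε → ∀ᶠ n : ℕ in atTop, ∀ j : ℕ, Central k n j →
      (#((slice n j).filter fun x => 2 ≤ cliqueCount n k x) : ℝ) ≤
        ((1 / (k.factorial : ℝ)) ^ 2 / 2 + ε) * #(slice n j)) →
    (∀ c : ℕ, 2 ≤ c → ∃ k : ℕ, 3 ≤ k ∧ ∃ δ : ℝ, (1 / (k.factorial : ℝ)) ^ 2 < δ ∧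
      ∀ᶠ n : ℕ in atTop, ∀ j : ℕ, Central k n j → ∀ C : Circuit (Edge n), C.IsOver monotoneBasis →
        (#((slice n j).filter fun x => C.eval x ≠ decide (¬ 2 ∣ cliqueCount n k x)) : ℝ) ≤ δ * #(slice n j) →
          n ^ c < C.size) →
    ∀ c : ℕ, ∃ k : ℕ, 3 ≤ k ∧ ∃ δ : ℝ, 0 < δ ∧
      ∀ᶠ n : ℕ in atTop, ∀ j : ℕ, Central k n j → ∀ C : Circuit (Edge n), C.IsOver monotoneBasis →
        (#(errSet n k j C) : ℝ) ≤ δ * #(slice n j) → n ^ c < C.size := by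
  intro hTouch hFib hLow hUp hTail hPar c
  rcases Nat.lt_or_ge c 2 with hc | hc
  · obtain ⟨δ, hδ, h⟩ := sliceLB_of_locality (c := c) (by omega) hTouch hFib hLow hUp
    exact ⟨4, by norm_num, δ, hδ, h⟩
  · obtain ⟨k, hk, δ, hδ, hP⟩ := hPar c hc
    obtain ⟨δ', hδ', h⟩ := sliceLB_of_parity hδ (hTail k hk) hP
    exact ⟨k, hk, δ', hδ', h⟩

end

end Summit.PneNP.PneNP.Cruxes.SliceTarget.Ideator3Line
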